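/-
Origin: expansion seat `planner-pub-hodgecm-mc-sanity-1-0`, handover #8 2026-08-18T19:46Z md5 e3014f5fe7d1 (NEW additive leaf, 249 l.; imports Sanity.LevelMeetToys (row 11) + HodgeCM.Model.EndStateMeet = prl1-g11 E4 36df9bfc95bc (their kit row #5); install after those) (`HOME/mc/pub-hodgecm-mc-sanity-1/lean/MeetRecord.lean`, md5 e3014f5f, 249 lines);
landed by the packager successor (mc-unitary-1-g3, gen-8 kit) in gate run 32 as `HodgeCM/Model/Sanity/MeetRecord.lean` (verbatim).
-/
/-
Copyright: pub-hodgecm MODEL-CONSTRUCTION cell, 2026-08-18. Seat planner-pub-hodgecm-mc-sanity-1-0 (node SAN: toy-instance /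
degenerate-instance sanity, OFF the E2 path). KERNEL ONLY: 0 records, 0 cited hypotheses, 0 proof holes.

# Sanity rows for the E4 MEETING record `AllCharsNonDesignPt₂ S` (prl1-g11 `Model/EndStateMeet.lean`, md5 36df9bfc95bc)

Intended install path `HodgeCM/Model/Sanity/MeetRecord.lean` (additive leaf). Imports the END-STATE owner's E4 leaf
`HodgeCM.Model.EndStateMeet` (six inputs C2, C3, C4, C5′ `gen12Meet`, C6′ `real34Meet`, C7; headline
`Assembly.perL_ofSignRecipe₁₀`) and this seat's `Sanity/LevelMeetToys.lean` (#7; hence `PointwiseRecord`, `PointwiseSanity`,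
`Toy3Cores`).  The owner noted (STATUS 19:41:50Z) that the E3 no-go rows transfer along `toMeet₂` only in the direction
Pt₁ ⇒ Pt₂, so a no-go for Pt₂ needs its own witness — this file supplies it; nothing restated, no new axioms.

§1 DEGENERATE-SATISFIABILITY of the two new fields: at a zero-kernel context `Gen12MeetAt V c` ⟺ "`emb` kills every theta
wedge of the context" (`gen12MeetAt_iff_of_zeroKernelsAt`, same right-hand side as for C5, `PointwiseSanity.gen12AllAt_iff…`),
`Real34MeetAt V c` HOLDS (vacuously: `ϑ₃₄ = 0`); and for `emb = 0` at the levels of `V` BOTH hold vacuously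
(`gen12MeetAt_of_emb_eq_zero`, `real34MeetAt_of_emb_eq_zero`).  So under E4 the non-degeneracy content is still exactly
C2 + C4 + the kernels.

§2 NO-GO: `false_of_zeroKernelsAt₂ M hHR hθ h₂ h₅ h₆ h₇'` (h₇' := C5′), `not_allCharsNonDesignPt₂_of_zeroKernelsAt`,
`not_allCharsNonDesignPt₂_sextic_of_zeroKernels`, `…_withDegenerateWM`, `Universe.not_thetaModelExists_sextic₂_witness_withDegenerateWM`
(the `wm` slot stays load-bearing under the weakest end state of record `ThetaModelExists_sextic₂`), and the POINTWISE
extraction `exists_theta_ne_zero_at_of_local₂` / `exists_theta_ne_zero_of_allCharsNonDesignPt₂` (ref3 R2 at C for ₁₀).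

§3 TOY PROFILE of the E4 record: `AllCharsNonDesignPt₂ (finrank = 6)` is ✗ for both toy cores and any transfer `J`
(`not_nullCore₃_allCharsNonDesignPt₂_sextic`, `not_gramCore₃_allCharsNonDesignPt₂_sextic`, `toyProfilePt₂`).
-/
import Summits.HodgeConjecture.HodgeCM.Model.Sanity.LevelMeetToys
import Summits.HodgeConjecture.HodgeCM.Model.EndStateMeet_2

set_option autoImplicit false

noncomputable section

open HodgeCM HodgeCM.Universe HodgeCM.ToyG2 HodgeCM.ToyG2.ThetaUiso MeasureTheory
open scoped InnerProductSpace
open Literature.AlgebraicGeometry.Motives (HodgeStructure)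
open Literature.AlgebraicGeometry.Motives.HodgeStructure (conj)

attribute [-instance] Quotient.instMeasurableSpace

namespace HodgeCM

/-! ## §1 The two new fields are degenerate-satisfiable -/

/-- `Gen12MeetAt V c` holds VACUOUSLY for `emb = 0` at the levels of `V` (the premiss `Λ ≠ 0` never fires). -/
theorem Universe.ThetaModel.gen12MeetAt_of_emb_eq_zero {U : Universe} (T : U.ThetaModel) {L : CMField} {ι₁ : L →+* ℂ}
    (V : HermSpace3 L ι₁) (c : SeesawCtx L) (hE : ∀ Γ : Level V, T.emb Γ = 0) : T.Gen12MeetAt V c := by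
  intro Γ ω₁ ω₂ _ _ hne
  exact absurd (by rw [T.Λ_apply Γ, hE Γ, LinearMap.zero_apply]) hne

/-- `Real34MeetAt V c` holds VACUOUSLY for `emb = 0` at the levels of `V` (the premiss `⟪Λ, ϑ₃₄⟫ ≠ 0` never fires). -/
theorem Universe.ThetaModel.real34MeetAt_of_emb_eq_zero {U : Universe} (T : U.ThetaModel) {L : CMField} {ι₁ : L →+* ℂ}
    (V : HermSpace3 L ι₁) (c : SeesawCtx L) (hE : ∀ Γ : Level V, T.emb Γ = 0) : T.Real34MeetAt V c := by
  intro χ Φ Γ₁ ω₁ ω₂ _ _ hne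
  exact absurd (by rw [T.Λ_apply Γ₁, hE Γ₁, LinearMap.zero_apply, inner_zero_left]) hne

namespace Universe.AdelicThetaCore

section E4

variable {U : Universe} {hP : PrintFact_unitaryCompact} {C : U.AdelicThetaCore hP} (h : Bool)
variable (d12 d34 : ∀ {L : CMField}, SeesawCtx L → SideData L)
variable {S : ∀ {L : CMField}, SeesawCtx L → Prop}
variable {L : CMField} {ι₁ : L →+* ℂ} {V : HermSpace3 L ι₁} {c : SeesawCtx L}

/-- **C5′ at a zero-kernel context ⟺ `emb` kills every theta wedge of the context** (all `ϑ₁₂(χ,Φ) = 0`, so a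
non-zero wedge can pair with none of them) — the same right-hand side as for C5 (`gen12AllAt_iff_of_zeroKernelsAt`). -/
theorem gen12MeetAt_iff_of_zeroKernelsAt (hθ : C.ZeroKernelsAt V c) :
    (C.thetaModel h d12 d34).Gen12MeetAt V c ↔
      ∀ (Γ : Level V) (ω₁ ω₂ : U.CohC (U.pms L ι₁ V Γ) 1), ω₁ ∈ C.Theta V c 0 Γ → ω₂ ∈ C.Theta V c 1 Γ →
        C.emb Γ (U.cup2C (U.pms L ι₁ V Γ) 1 ω₁ ω₂) = 0 := by
  constructor
  · intro H Γ ω₁ ω₂ h₁ h₂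
    by_contra hne
    obtain ⟨χ, Φ, hχ⟩ := H Γ ω₁ ω₂ h₁ h₂ hne
    rw [C.thetaModel_ϑ12_eq_zero h d12 d34 V c hθ χ Φ, inner_zero_right] at hχ
    exact hχ rfl
  · intro H Γ ω₁ ω₂ h₁ h₂ hne
    exact absurd (H Γ ω₁ ω₂ h₁ h₂) hne

/-- **C6′ HOLDS at a zero-kernel context** (all `ϑ₃₄(χ,Φ) = 0`: the premiss never fires). -/
theorem real34MeetAt_of_zeroKernelsAt (hθ : C.ZeroKernelsAt V c) : (C.thetaModel h d12 d34).Real34MeetAt V c := by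
  intro χ Φ Γ₁ ω₁ ω₂ _ _ hne
  rw [C.thetaModel_ϑ34_eq_zero h d12 d34 V c hθ χ Φ, inner_zero_right] at hne
  exact absurd rfl hne

/-- `Gen12MeetAt` / `Real34MeetAt` for the zero-embedding cores (any `wm`, `Theta`): vacuous. -/
theorem gen12MeetAt_of_zeroEmb (he : C.ZeroEmb) (V : HermSpace3 L ι₁) (c : SeesawCtx L) :
    (C.thetaModel h d12 d34).Gen12MeetAt V c ∧ (C.thetaModel h d12 d34).Real34MeetAt V c :=
  have hE : ∀ Γ : Level V, (C.thetaModel h d12 d34).emb Γ = 0 := fun Γ =>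
    LinearMap.ext fun η => by rw [C.thetaModel_emb h d12 d34, he Γ]; rfl
  ⟨(C.thetaModel h d12 d34).gen12MeetAt_of_emb_eq_zero V c hE, (C.thetaModel h d12 d34).real34MeetAt_of_emb_eq_zero V c hE⟩

/-! ## §2 No-go for the E4 record at one good `S`-context with zero kernels -/

/-- **NO-GO at the meeting end state.**  Over the five PerL model facts and HR(2,0): zero kernels at `(V, c)` are
incompatible with the local bodies C2 (`InnerEmbAt V`), C3, C4 and C5′ (`Gen12MeetAt V c`) of E4. -/
theorem false_of_zeroKernelsAt₂ (M : U.ModelAxiomsPerL) (hHR : U.Fact_hodgeRiemann20) (hθ : C.ZeroKernelsAt V c)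
    (h₂ : (C.thetaModel h d12 d34).InnerEmbAt V)
    (h₅ : ∀ (i : Fin 4) (Γ : Level V), (C.thetaModel h d12 d34).Theta V c i Γ ⊆ U.Uiso Γ c.K (c.Ψ i) c.σ)
    (h₆ : ∃ Γ : Level V, ∃ ω₁ ∈ (C.thetaModel h d12 d34).Theta V c 0 Γ, ∃ ω₂ ∈ (C.thetaModel h d12 d34).Theta V c 1 Γ,
      U.cup2C (U.pms L ι₁ V Γ) 1 ω₁ ω₂ ≠ 0)
    (h₇' : (C.thetaModel h d12 d34).Gen12MeetAt V c) : False :=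
  false_of_zeroKernelsAt h d12 d34 M hHR hθ h₂ h₅ h₆
    ((gen12AllAt_iff_of_zeroKernelsAt h d12 d34 hθ).mpr ((gen12MeetAt_iff_of_zeroKernelsAt h d12 d34 hθ).mp h₇'))

/-- **POINTWISE non-degeneracy witness (R2 at C, meeting form)**: the local bodies C2, C3, C4, C5′ at `(V, c)` force a
nonzero theta kernel of the core AT `(V, c)`. -/
theorem exists_theta_ne_zero_at_of_local₂ (M : U.ModelAxiomsPerL) (hHR : U.Fact_hodgeRiemann20)
    (h₂ : (C.thetaModel h d12 d34).InnerEmbAt V)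
    (h₅ : ∀ (i : Fin 4) (Γ : Level V), (C.thetaModel h d12 d34).Theta V c i Γ ⊆ U.Uiso Γ c.K (c.Ψ i) c.σ)
    (h₆ : ∃ Γ : Level V, ∃ ω₁ ∈ (C.thetaModel h d12 d34).Theta V c 0 Γ, ∃ ω₂ ∈ (C.thetaModel h d12 d34).Theta V c 1 Γ,
      U.cup2C (U.pms L ι₁ V Γ) 1 ω₁ ω₂ ≠ 0)
    (h₇' : (C.thetaModel h d12 d34).Gen12MeetAt V c) :
    ∃ (Φ : (C.wm V c).SK) (p : _), (C.wm V c).θ Φ p ≠ 0 := by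
  by_contra H
  refine false_of_zeroKernelsAt₂ h d12 d34 M hHR (fun Φ => DFunLike.ext _ _ fun p => ?_) h₂ h₅ h₆ h₇'
  by_contra hp
  exact H ⟨Φ, p, fun h0 => hp (by rw [h0]; rfl)⟩

/-- **A core with vanishing theta kernels at ONE good `S`-context is never an E4 witness `AllCharsNonDesignPt₂ S`.** -/
theorem not_allCharsNonDesignPt₂_of_zeroKernelsAt (M : U.ModelAxiomsPerL) (hHR : U.Fact_hodgeRiemann20)
    (hc : (C.thetaModel h d12 d34).GoodCtx ι₁ c) (hSc : S c) (hθ : C.ZeroKernelsAt V c) :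
    ¬ (C.thetaModel h d12 d34).AllCharsNonDesignPt₂ S := fun A =>
  false_of_zeroKernelsAt₂ h d12 d34 M hHR hθ (A.innerEmb V c hc hSc) (A.thetaSub V c hc hSc)
    (A.thetaWedge V c hc hSc) (A.gen12Meet V c hc hSc)

/-- **Non-degeneracy from an E4 witness**: a nonzero theta kernel at EVERY good `S`-context. -/
theorem exists_theta_ne_zero_of_allCharsNonDesignPt₂ (M : U.ModelAxiomsPerL) (hHR : U.Fact_hodgeRiemann20)
    (A : (C.thetaModel h d12 d34).AllCharsNonDesignPt₂ S) (V : HermSpace3 L ι₁) (c : SeesawCtx L)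
    (hc : (C.thetaModel h d12 d34).GoodCtx ι₁ c) (hSc : S c) :
    ∃ (Φ : (C.wm V c).SK) (p : _), (C.wm V c).θ Φ p ≠ 0 :=
  exists_theta_ne_zero_at_of_local₂ h d12 d34 M hHR (A.innerEmb V c hc hSc) (A.thetaSub V c hc hSc)
    (A.thetaWedge V c hc hSc) (A.gen12Meet V c hc hSc)

variable (C)

/-- **Zero-kernel cores are never witnesses of the SEXTIC-restricted E4 record** (a good sextic context exists). -/
theorem not_allCharsNonDesignPt₂_sextic_of_zeroKernels (M : U.ModelAxiomsPerL) (hHR : U.Fact_hodgeRiemann20)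
    (hθ : C.ZeroKernels) :
    ¬ (C.thetaModel h d12 d34).AllCharsNonDesignPt₂ (fun c => Module.finrank ℚ c.K = 6) := by
  obtain ⟨L, ι₁, V, c, hc, h6⟩ := exists_signRecipe_goodCtx_sextic (h := h) C d12 d34
  exact not_allCharsNonDesignPt₂_of_zeroKernelsAt h d12 d34 M hHR
    ((C.thetaModel_goodCtx_iff h d12 d34 ι₁ c).mpr hc) h6 ((C.zeroKernels_iff_forall_at).mp hθ V c)

/-- In particular for the degenerate placeholder core `withDegenerateWM` (any `emb`, `cover`, `Theta`). -/
theorem not_allCharsNonDesignPt₂_sextic_withDegenerateWM (M : U.ModelAxiomsPerL) (hHR : U.Fact_hodgeRiemann20) :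
    ¬ (C.withDegenerateWM.thetaModel h d12 d34).AllCharsNonDesignPt₂ (fun c => Module.finrank ℚ c.K = 6) :=
  not_allCharsNonDesignPt₂_sextic_of_zeroKernels _ h d12 d34 M hHR (C.withDegenerateWM_zeroKernels)

end E4

end Universe.AdelicThetaCore

/-- **The degenerate core is not a witness of the sextic E4 hypothesis `ThetaModelExists_sextic₂` in the `wm` slot**
(so `⟨h, C.withDegenerateWM, d12, d34, _⟩` is never the anonymous-constructor term of `ThetaModelExists_sextic₂`, the
hypothesis of `Assembly.perL_of_thetaModelExists_sextic₂` / `perL_ofSignRecipe₁₀`). -/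
theorem Universe.not_thetaModelExists_sextic₂_witness_withDegenerateWM {U : Universe} (M : U.ModelAxiomsPerL)
    (hHR : U.Fact_hodgeRiemann20) (h : Bool) (C : U.AdelicThetaCore₀)
    (d12 d34 : ∀ {L : CMField}, SeesawCtx L → SideData L) :
    ¬ (C.withDegenerateWM.thetaModel h d12 d34).AllCharsNonDesignPt₂ (fun c => Module.finrank ℚ c.K = 6) :=
  Universe.AdelicThetaCore.not_allCharsNonDesignPt₂_sextic_withDegenerateWM C h d12 d34 M hHR

end HodgeCM

/-! ## §3 Toy profile of the E4 record `AllCharsNonDesignPt₂ (finrank = 6)`: ✗ for both cores -/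

namespace HodgeCM.Sanity.Toy3

variable (d t : ℚ) (hd : (1 : ℚ) ≤ d) (ht : t ^ 2 = 16) (hP : PrintFact_unitaryCompact) (h : Bool)
variable (d12 d34 : ∀ {L : CMField}, SeesawCtx L → SideData L)

include hd ht in
/-- **The all-zero core is not an E4 witness (sextic class)** — C2 alone fails at a good sextic context, as for Pt₁. -/
theorem not_nullCore₃_allCharsNonDesignPt₂_sextic :
    ¬ ((nullCore₃ d t hP).thetaModel h d12 d34).AllCharsNonDesignPt₂ (fun c => Module.finrank ℚ c.K = 6) := by
  intro A
  obtain ⟨F, ι₁, V, c, hc, h6⟩ :=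
    AdelicThetaCore.exists_signRecipe_goodCtx_sextic (h := h) (nullCore₃ d t hP) d12 d34
  obtain ⟨j, hj, -⟩ := hc.forced
  have hm : ∀ i, ι₁.comp j ∈ (c.Ψ i).1 := fun i => hj ▸ hc.mem i
  obtain ⟨Γ⟩ := Level.nonempty V
  obtain ⟨a, ha, H⟩ :=
    A.innerEmb V c (((nullCore₃ d t hP).thetaModel_goodCtx_iff h d12 d34 ι₁ c).mpr hc) h6 Γ
  have hne : Λ ι₁ d t hd ht (thetaE d t ι₁ j c.Ψ hc.pairSum hm 0) (thetaE d t ι₁ j c.Ψ hc.pairSum hm 1) ≠ 0 :=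
    Λ_thetaE01_ne_zero d t ι₁ hd ht j c.Ψ hc.pairSum hm
  have hη : (toyUniverse₃ d t).cup2C ((toyUniverse₃ d t).pms F ι₁ V Γ) 1 (thetaE d t ι₁ j c.Ψ hc.pairSum hm 0)
      (thetaE d t ι₁ j c.Ψ hc.pairSum hm 1) ∈ ((toyUniverse₃ d t).hodge ((toyUniverse₃ d t).pms F ι₁ V Γ) 2).F 2 :=
    Universe.cup2C_mem_F2 (toyUniverse₃_modelAxioms_all d t) _
      (hr3_eCls_mem_H10 d t ι₁ Γ (qΨ ι₁ j c.Ψ hc.pairSum hm) 0) (hr3_eCls_mem_H10 d t ι₁ Γ (qΨ ι₁ j c.Ψ hc.pairSum hm) 1)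
  have hid := H _ _ hη hη
  have h0 : ((nullCore₃ d t hP).thetaModel h d12 d34).emb Γ ((toyUniverse₃ d t).cup2C ((toyUniverse₃ d t).pms F ι₁ V Γ) 1
      (thetaE d t ι₁ j c.Ψ hc.pairSum hm 0) (thetaE d t ι₁ j c.Ψ hc.pairSum hm 1)) = 0 := rfl
  rw [h0, inner_zero_left, hr3g_gram d t ι₁ Γ hd ht hη hη, hr3g_Lam_cup] at hid
  exact (mul_ne_zero ha (mul_ne_zero (by norm_num) (inner_self_ne_zero.mpr hne))) hid.symm

variable (J : Transfer hP)

/-- **The Gram core is not an E4 witness (sextic class), for ANY transfer `J`**: at a good sextic context C2 makes `J_V`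
faithful on the Gram vector `Λ(E₀,E₁) ≠ 0` while C5′ (zero kernels: every `ϑ₁₂(χ,Φ) = 0`) makes `J_V` kill it. -/
theorem not_gramCore₃_allCharsNonDesignPt₂_sextic :
    ¬ ((gramCore₃ d t hd ht hP J).thetaModel h d12 d34).AllCharsNonDesignPt₂ (fun c => Module.finrank ℚ c.K = 6) := by
  intro A
  obtain ⟨F, ι₁, V, c, hc, h6⟩ :=
    AdelicThetaCore.exists_signRecipe_goodCtx_sextic (h := h) (gramCore₃ d t hd ht hP J) d12 d34
  have hc' : ((gramCore₃ d t hd ht hP J).thetaModel h d12 d34).GoodCtx ι₁ c :=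
    ((gramCore₃ d t hd ht hP J).thetaModel_goodCtx_iff h d12 d34 ι₁ c).mpr hc
  obtain ⟨j, hj, -⟩ := hc.forced
  have hm : ∀ i, ι₁.comp j ∈ (c.Ψ i).1 := fun i => hj ▸ hc.mem i
  obtain ⟨Γ⟩ := Level.nonempty V
  obtain ⟨a, ha, H⟩ := A.innerEmb V c hc' h6 Γ
  have hkillAll := (AdelicThetaCore.gen12MeetAt_iff_of_zeroKernelsAt h d12 d34
    (((gramCore₃ d t hd ht hP J).zeroKernels_iff_forall_at).mp (gramCore₃_zeroKernels d t hd ht hP J) V c)).mp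
    (A.gen12Meet V c hc' h6)
  have h₁ : thetaE d t ι₁ j c.Ψ hc.pairSum hm 0 ∈ thetaSet₃ d t ι₁ V c 0 Γ := ⟨j, hc.pairSum, hm, hj, rfl⟩
  have h₂ : thetaE d t ι₁ j c.Ψ hc.pairSum hm 1 ∈ thetaSet₃ d t ι₁ V c 1 Γ := ⟨j, hc.pairSum, hm, hj, rfl⟩
  have hkill : J V (Λ ι₁ d t hd ht (thetaE d t ι₁ j c.Ψ hc.pairSum hm 0) (thetaE d t ι₁ j c.Ψ hc.pairSum hm 1)) = 0 := by
    have h0 := hkillAll Γ _ _ h₁ h₂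
    rwa [gramCore₃_emb, hr3g_Lam_cup] at h0
  have hne : Λ ι₁ d t hd ht (thetaE d t ι₁ j c.Ψ hc.pairSum hm 0) (thetaE d t ι₁ j c.Ψ hc.pairSum hm 1) ≠ 0 :=
    Λ_thetaE01_ne_zero d t ι₁ hd ht j c.Ψ hc.pairSum hm
  have hη : (toyUniverse₃ d t).cup2C ((toyUniverse₃ d t).pms F ι₁ V Γ) 1 (thetaE d t ι₁ j c.Ψ hc.pairSum hm 0)
      (thetaE d t ι₁ j c.Ψ hc.pairSum hm 1) ∈ ((toyUniverse₃ d t).hodge ((toyUniverse₃ d t).pms F ι₁ V Γ) 2).F 2 :=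
    Universe.cup2C_mem_F2 (toyUniverse₃_modelAxioms_all d t) _
      (hr3_eCls_mem_H10 d t ι₁ Γ (qΨ ι₁ j c.Ψ hc.pairSum hm) 0) (hr3_eCls_mem_H10 d t ι₁ Γ (qΨ ι₁ j c.Ψ hc.pairSum hm) 1)
  have hid := H _ _ hη hη
  have h0 : ((gramCore₃ d t hd ht hP J).thetaModel h d12 d34).emb Γ ((toyUniverse₃ d t).cup2C
      ((toyUniverse₃ d t).pms F ι₁ V Γ) 1 (thetaE d t ι₁ j c.Ψ hc.pairSum hm 0) (thetaE d t ι₁ j c.Ψ hc.pairSum hm 1)) = 0 := by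
    show J V (hr3g_Lam d t ι₁ Γ hd ht ((toyUniverse₃ d t).cup2C ((toyUniverse₃ d t).pms F ι₁ V Γ) 1
      (thetaE d t ι₁ j c.Ψ hc.pairSum hm 0) (thetaE d t ι₁ j c.Ψ hc.pairSum hm 1))) = 0
    rw [hr3g_Lam_cup]
    exact hkill
  rw [h0, inner_zero_left, hr3g_gram d t ι₁ Γ hd ht hη hη, hr3g_Lam_cup] at hid
  exact (mul_ne_zero ha (mul_ne_zero (by norm_num) (inner_self_ne_zero.mpr hne))) hid.symm

/-- **TOY PROFILE OF THE E4 RECORD**: C5′/C6′ are ✓ for the null core (zero embedding, vacuous) and the record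
`AllCharsNonDesignPt₂ (finrank = 6)` is ✗ for both cores (any `J`) — the toys fail E4 exactly where they failed E2/E3. -/
theorem toyProfilePt₂ :
    (∀ {L : CMField} {ι₁ : L →+* ℂ} (V : HermSpace3 L ι₁) (c : SeesawCtx L),
        ((nullCore₃ d t hP).thetaModel h d12 d34).Gen12MeetAt V c ∧ ((nullCore₃ d t hP).thetaModel h d12 d34).Real34MeetAt V c) ∧
      ¬ ((nullCore₃ d t hP).thetaModel h d12 d34).AllCharsNonDesignPt₂ (fun c => Module.finrank ℚ c.K = 6) ∧
      ¬ ((gramCore₃ d t hd ht hP J).thetaModel h d12 d34).AllCharsNonDesignPt₂ (fun c => Module.finrank ℚ c.K = 6) :=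
  ⟨fun V c => AdelicThetaCore.gen12MeetAt_of_zeroEmb h d12 d34 (nullCore₃_zeroEmb d t hP) V c,
    not_nullCore₃_allCharsNonDesignPt₂_sextic d t hd ht hP h d12 d34,
    not_gramCore₃_allCharsNonDesignPt₂_sextic d t hd ht hP h d12 d34 J⟩

end HodgeCM.Sanity.Toy3

end
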